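import Summits.CriticalPhenomena.PercolationContinuityZ3.Theorems.Transplant.CayleyCylinderKit
import HarnessLib

/-!
# Cylinders of a Cayley-graph skeleton, III: the cycle kit of a small-cylinder edge, its zone radius, column classes

builds on p205010 (kernel theorem, internal audit signed; external expert review pending) — nothing in this file uses p205010.
Lane `prim-bschramm`, seat `prim-bschramm-p4` gen 10 (PART C3, tier 2′ of `P4-GENERAL.md`).  Helper file
(`--supports stmt-CriticalPhenomena-4575 --as helper`).  Sequel of `CayleyCylinderKit`.

* `CylData.kit` — the `SubLoc.CycleKit` of an edge `{x, y}` of the big cylinder graph `H = Cay(Γ;S)[‖φ‖_∞ ≤ ℓ+1]` with both ends in the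
  small cylinder `‖φ‖_∞ ≤ ℓ` and `y ≠ x s₀⁻¹` (column of `x` down, frame, column of `y` up; enhancement class = `H`-edges not inside the
  small cylinder);
* `CylData.kit_Z_subset` — the whole kit lies in `B_H(x, R ℓ)` for a radius `R ℓ` depending only on `ℓ` (the kernel words closing the frames
  range over the finite ball of radius `10(ℓ+1)+1` of `Cay(Γ;S)`);
* `CylData.cls` — the column class `g ↦ g s₀^{−φ₀ g}`, constant on both columns of the kit.
-/

noncomputable section

namespace Summit.CriticalPhenomena.PercolationContinuityZ3.Theorems.Transplant

namespace CayCyl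

open SimpleGraph Walk Literature.Probability.LatticeModels SubLoc
open Literature.Barriers.CriticalPhenomena (graphBall graphBall_mono mem_graphBall_self graphBall_finite)
open scoped Classical

variable {Γ : Type} [Group Γ] {S : Finset Γ}

namespace CylData

variable (D : CylData Γ S)

/-- Powers of `s₀⁻¹` are distinct. [folklore] -/
theorem s₀inv_pow_injective (i j : ℕ) (h : D.s₀⁻¹ ^ i = D.s₀⁻¹ ^ j) : i = j := by
  rw [inv_pow, inv_pow, inv_inj] at h
  exact D.s₀_pow_injective i j h

section Kit

variable {ℓ : ℕ} (x y : D.V (ℓ + 1))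

/-- **The enhancement class**: edges of the big cylinder graph not inside the small cylinder `‖φ‖_∞ ≤ ℓ`. [folklore] -/
def Eenh (ℓ : ℕ) : Set (Sym2 (D.V (ℓ + 1))) := {d | d ∈ (D.cylG (ℓ + 1)).edgeSet ∧ ¬ ∀ z ∈ d, D.φ z.1 ∈ box 2 ℓ}

/-- **THE CYCLE KIT of an edge `{x, y}` of the small cylinder** (`y ≠ x s₀⁻¹`): column of `x` down to the floor, the frame, column of `y`
up to the ceiling. [cite: BalisterBollobasRiordan2014, §"bond percolation" p. 13] -/
def kit (hx : D.φ x.1 ∈ box 2 ℓ) (hy : D.φ y.1 ∈ box 2 ℓ) (hadj : (D.cylG (ℓ + 1)).Adj x y) (hne : y.1 ≠ x.1 * D.s₀⁻¹) :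
    CycleKit (D.cylG (ℓ + 1)) (D.Eenh ℓ) x y where
  p := D.pV x
  q := D.qV y
  A := D.colA x
  M := D.pathM x y
  B := D.colB y
  hA := (isPath_induce_iff _ _).2 (isPath_powWalk _ D.s₀inv_pow_injective _ _)
  hM := bypass_isPath _
  hB := ((isPath_induce_iff _ _).2 (isPath_powWalk _ D.s₀_pow_injective _ _)).reverse
  hpq := fun h => by
    have h1 := (D.φ_pt x).1; have h2 := (D.φ_qt y).1
    have e : D.pt x = D.qt y := congrArg Subtype.val h
    rw [e, h2] at h1; omega
  hxp := fun h => by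
    have h1 := (D.φ_pt x).1
    have hx0 := (D.mem_box_iff.1 hx).1; rw [abs_le] at hx0
    have e : x.1 = D.pt x := congrArg Subtype.val h
    rw [← e] at h1; omega
  hqy := fun h => by
    have h1 := (D.φ_qt y).1
    have hy0 := (D.mem_box_iff.1 hy).1; rw [abs_le] at hy0
    have e : D.qt y = y.1 := congrArg Subtype.val h
    rw [e] at h1; omega
  hAM := fun w hwA hwM => by
    obtain ⟨i, hi, hw⟩ := D.mem_colA x hwA
    have hfr := (D.frame_mem x y (D.mem_pathM x y hwM)).2
    have hc := D.φ_s₀inv_pow x.1 i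
    have hxb := D.mem_box_iff.1 hx; rw [abs_le, abs_le] at hxb
    have hwV := D.memV.1 w.2; rw [abs_le, abs_le] at hwV
    rw [D.mem_box_iff, abs_le, abs_le] at hfr
    rw [hw, hc.1, hc.2] at hfr hwV
    have hi' : (i : ℤ) ≤ D.nA x := by exact_mod_cast hi
    have e := D.nA_eq x
    have hinA : i = D.nA x := by omega
    apply Subtype.ext
    rw [hw, hinA]
  hMB := fun w hwM hwB => by
    obtain ⟨j, hj, hw⟩ := D.mem_colB y hwB
    have hfr := (D.frame_mem x y (D.mem_pathM x y hwM)).2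
    have hc := D.φ_s₀_pow y.1 j
    have hyb := D.mem_box_iff.1 hy; rw [abs_le, abs_le] at hyb
    have hwV := D.memV.1 w.2; rw [abs_le, abs_le] at hwV
    rw [D.mem_box_iff, abs_le, abs_le] at hfr
    rw [hw, hc.1, hc.2] at hfr hwV
    have hj' : (j : ℤ) ≤ D.nB y := by exact_mod_cast hj
    have e := D.nB_eq y
    have hjnB : j = D.nB y := by omega
    apply Subtype.ext
    rw [hw, hjnB]
  hAB := fun w hwA hwB => by
    obtain ⟨i, -, hw1⟩ := D.mem_colA x hwA
    obtain ⟨j, -, hw2⟩ := D.mem_colB y hwB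
    have key : x.1 * D.s₀⁻¹ ^ i = y.1 * D.s₀ ^ j := hw1.symm.trans hw2
    have hG : (mulCayley (S : Set Γ)).Adj x.1 y.1 := hadj
    have hlip := D.lip_adj hG 0
    rw [abs_le] at hlip
    have h0 := congrArg (fun g => D.φ g 0) key
    simp only [(D.φ_s₀inv_pow x.1 i).1, (D.φ_s₀_pow y.1 j).1] at h0
    have hij : i + j = 0 ∨ i + j = 1 := by omega
    rcases hij with hij | hij
    · obtain ⟨rfl, rfl⟩ : i = 0 ∧ j = 0 := by omega
      simp only [pow_zero, mul_one] at key
      exact hG.ne key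
    · rcases (show (i = 1 ∧ j = 0) ∨ (i = 0 ∧ j = 1) by omega) with ⟨rfl, rfl⟩ | ⟨rfl, rfl⟩
      · simp only [pow_one, pow_zero, mul_one] at key
        exact hne key.symm
      · simp only [pow_zero, mul_one, pow_one] at key
        exact hne (by rw [key, mul_inv_cancel_right])
  hME := fun d hd => by
    refine ⟨Walk.edges_subset_edgeSet _ hd, fun hall => ?_⟩
    induction d using Sym2.inductionOn with
    | hf a b =>
      have ha : a ∈ (D.pathM x y).support := Walk.fst_mem_support_of_mem_edges _ hd
      exact (D.frame_mem x y (D.mem_pathM x y ha)).2 (hall a (Sym2.mem_mk_left _ _))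
  hyx := hadj.symm

/-! ## §2 The zone radius -/

/-- The kernel words that may close a frame at level `ℓ`: those of the ball of radius `10(ℓ+1)+1`. [folklore] -/
def kball (S : Finset Γ) (ℓ : ℕ) : Finset Γ := (graphBall_finite (mulCayley (S : Set Γ)) (1 : Γ) (10 * (ℓ + 1) + 1)).toFinset

/-- The uniform bound on the kernel words of level `ℓ`. [folklore] -/
def Kmax (ℓ : ℕ) : ℕ := (kball S ℓ).sup D.kerWalkLen

/-- **The zone radius** `R ℓ = 10(ℓ+1) + Kmax ℓ + 1`. [folklore] -/
def R (ℓ : ℕ) : ℕ := 10 * (ℓ + 1) + D.Kmax ℓ + 1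

/-- The four step counts are at most `2(ℓ+1)`. [folklore] -/
theorem counts_le : D.nA x ≤ 2 * (ℓ + 1) ∧ D.nB y ≤ 2 * (ℓ + 1) ∧ D.m₁ x ≤ 2 * (ℓ + 1) ∧ D.m₂ y ≤ 2 * (ℓ + 1) := by
  have hx := D.memV.1 x.2; have hy := D.memV.1 y.2
  rw [abs_le, abs_le] at hx hy
  have e1 := D.nA_eq x; have e2 := D.nB_eq y; have e3 := D.m₁_eq x; have e4 := D.m₂_eq y
  refine ⟨?_, ?_, ?_, ?_⟩ <;> omega

/-- **The closing kernel element lies in the ball of radius `10(ℓ+1)+1`** (walk back along the frame, up the column of `x`, across the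
edge, up the column of `y`). [folklore] -/
theorem kel_mem_kball (hadj : (D.cylG (ℓ + 1)).Adj x y) : D.kel x y ∈ kball S ℓ := by
  have hG : (mulCayley (S : Set Γ)).Adj x.1 y.1 := hadj
  -- the walk from `c₃` to `q`
  set W : (mulCayley (S : Set Γ)).Walk (D.c₃ x y) (D.qt y) :=
    (((powWalk S D.adj_s₁ (D.pt x) (D.m₁ x)).append
      ((powWalk S D.adj_s₀ (D.pt x * D.s₁ ^ D.m₁ x) (2 * (ℓ + 1))).append
        (powWalk S D.adj_s₁_inv (D.pt x * D.s₁ ^ D.m₁ x * D.s₀ ^ (2 * (ℓ + 1))) (D.m₂ y)))).reverse.append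
      ((powWalk S D.adj_s₀_inv x.1 (D.nA x)).reverse.append (Walk.cons hG (powWalk S D.adj_s₀ y.1 (D.nB y))))) with hW
  have hlen : W.length ≤ 10 * (ℓ + 1) + 1 := by
    have hc := D.counts_le x y
    simp only [hW, Walk.length_append, Walk.length_reverse, Walk.length_cons, length_powWalk]
    omega
  rw [kball, Set.Finite.mem_toFinset]
  refine ⟨(lmul S (D.c₃ x y)⁻¹ W).copy (inv_mul_cancel _) rfl, ?_⟩
  rw [length_copy, length_lmul]
  exact hlen

/-- The kernel word of the kit is bounded by `Kmax`. [folklore] -/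
theorem kerWalkLen_kel_le (hadj : (D.cylG (ℓ + 1)).Adj x y) : D.kerWalkLen (D.kel x y) ≤ D.Kmax ℓ :=
  Finset.le_sup (f := D.kerWalkLen) (D.kel_mem_kball x y hadj)

/-- The frame path is short: `|M| ≤ 6(ℓ+1) + Kmax`. [folklore] -/
theorem length_pathM_le (hadj : (D.cylG (ℓ + 1)).Adj x y) : (D.pathM x y).length ≤ 6 * (ℓ + 1) + D.Kmax ℓ := by
  refine (length_bypass_le_length _).trans ?_
  rw [length_induce, length_frame]
  have hc := D.counts_le x y
  have hk := D.kerWalkLen_kel_le x y hadj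
  omega

/-- **The whole kit lies in the ball of radius `R ℓ` about `x`.** [folklore] -/
theorem kit_Z_subset (hx : D.φ x.1 ∈ box 2 ℓ) (hy : D.φ y.1 ∈ box 2 ℓ) (hadj : (D.cylG (ℓ + 1)).Adj x y) (hne : y.1 ≠ x.1 * D.s₀⁻¹) :
    (D.kit x y hx hy hadj hne).Z ⊆ graphBall (D.cylG (ℓ + 1)) x (D.R ℓ) := by
  have hc := D.counts_le x y
  have hA : (D.colA x).length = D.nA x := by rw [colA, length_induce, length_powWalk]
  have hB : (D.colB y).length = D.nB y := by rw [colB, length_reverse, length_induce, length_powWalk]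
  have hM := D.length_pathM_le x y hadj
  rintro w (hw | hw | hw)
  · refine ⟨(D.colA x).takeUntil w hw, ?_⟩
    have := (D.colA x).length_takeUntil_le_length hw
    unfold R; omega
  · refine ⟨(D.colA x).append ((D.pathM x y).takeUntil w hw), ?_⟩
    have := (D.pathM x y).length_takeUntil_le_length hw
    rw [Walk.length_append]; unfold R; omega
  · have hw' : w ∈ (D.colB y).reverse.support := (mem_support_reverse_iff _ w).2 hw
    refine ⟨Walk.cons hadj ((D.colB y).reverse.takeUntil w hw'), ?_⟩
    have := (D.colB y).reverse.length_takeUntil_le_length hw'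
    rw [length_reverse] at this
    rw [Walk.length_cons]; unfold R; omega

/-! ## §3 Column classes -/

/-- **The column class** of `g`: the point of its `s₀`-column at height `0`. [folklore] -/
def cls (g : Γ) : Γ := g * D.s₀ ^ (-(D.φ g 0))

/-- The class is constant along `s₀`-columns. [folklore] -/
theorem cls_mul_s₀_zpow (g : Γ) (z : ℤ) : D.cls (g * D.s₀ ^ z) = D.cls g := by
  have h : D.φ (g * D.s₀ ^ z) 0 = D.φ g 0 + z := by rw [D.φ_mul_s₀_zpow]; simp
  rw [cls, cls, h, mul_assoc, ← zpow_add]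
  congr 2; ring

/-- `g = cls g · s₀^{φ₀ g}`. [folklore] -/
theorem cls_mul (g : Γ) : D.cls g * D.s₀ ^ (D.φ g 0) = g := by
  rw [cls, mul_assoc, ← zpow_add, neg_add_cancel, zpow_zero, mul_one]

/-- The column of `x` lies in the class of `x`. [folklore] -/
theorem cls_colA {w : D.V (ℓ + 1)} (hw : w ∈ (D.colA x).support) : D.cls w.1 = D.cls x.1 := by
  obtain ⟨i, -, h⟩ := D.mem_colA x hw
  rw [h, inv_pow, ← zpow_natCast, ← zpow_neg, cls_mul_s₀_zpow]

/-- The column of `y` lies in the class of `y`. [folklore] -/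
theorem cls_colB {w : D.V (ℓ + 1)} (hw : w ∈ (D.colB y).support) : D.cls w.1 = D.cls y.1 := by
  obtain ⟨j, -, h⟩ := D.mem_colB y hw
  rw [h, ← zpow_natCast, cls_mul_s₀_zpow]

end Kit

end CylData

end CayCyl

end Summit.CriticalPhenomena.PercolationContinuityZ3.Theorems.Transplant

end
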